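import Summits.ValiantsHypothesis.ValiantsHypothesis.Theorems.KPlusLogSqLawTropicalBHubLaw
import Summits.ValiantsHypothesis.ValiantsHypothesis.Theorems.KPlusLogSqLawTropicalBClassReversal

/-!
# Route «KPlusLogSqLaw», crux `TropicalB` (stmt-ValiantsHypothesis-19771) — THE CO-HUB LAW: the deactivation cycles of a state share a column

HONEST FRAMING.  Helper toward the registered stubs `stub_tropThin` / `stub_tropFat` of `Cruxes/TropicalB/Lines/birth.lean` (crux
`Summit.ValiantsHypothesis.ValiantsHypothesis.Theses.KPlusLogSqLaw.TropicalB`, item stmt-ValiantsHypothesis-19771, route KPlusLogSqLaw;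
cell `pub-symmetroid`, seat val-sym-trop-p5 g26, refuter-adjacent lane, 2026-08-29; `--supports … --as helper`).  A STRUCTURE law about
unique optima (`IsDominant`) of an ARBITRARY dominance design; nothing here bounds `TropicalB`, and nothing bears on `WeakLifting`,
DoorA26 / DoorA34, `MatrixDescartes` (stmt-ValiantsHypothesis-18050) or VP ≠ VNP.

THE LAW (`cohub_law`).  `T` a unique optimum; `B j` (`j` in a nonempty finite family) unique optima such that `T` is a SINGLE-TOKEN ACTIVATION
over each `B j` (classes of `T` = those of `B j` off one column `e j`, where `T`'s exponent is higher) — e.g. `T = M_S` and `B j = M_{S − x_j}`,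
`x_j ∈ S`, in a radix-2 odometer whose deactivations are clean.  THEN SOME COLUMN CARRIES, IN EVERY `B j`, A CELL DIFFERENT FROM `T`'s: the
deactivation cycles INTO a state pass through one common column, exactly as the activation cycles OUT of a state do (`hub_law`,
…TropicalBHubLaw).  Proof: the class-reversal duality (…TropicalBClassReversal: `d′ = D − d ∘ rev`, `θ ↦ −θ`, `revTerm`) turns `T` into a base
and every `B j` into a single-token activation over it; apply `hub_law` to the reversed design.  With both laws every state of a clean cube has
an OUT-hub and an IN-hub.

[this cell; folklore ingredients]
-/

set_option linter.dupNamespace false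
set_option autoImplicit false

namespace Summit.ValiantsHypothesis.ValiantsHypothesis.Theorems.KPlusLogSqLaw

namespace SingleContact

/-! ## 14. The co-hub law: deactivations of a state share a column (hub law of the class-reversed design) -/

section CoHub

open Summit.ValiantsHypothesis.ValiantsHypothesis.Theorems.MatrixDescartes.Negative
open Summit.ValiantsHypothesis.ValiantsHypothesis.Theorems.LacunarySymmetroidMatrixDescartes
open Finset

variable {m K : ℕ} (d : Fin K → ℕ) (v ε : Fin m → Fin m → Fin K → ℤ)

/-- **THE CO-HUB LAW.**  `T` a unique optimum; `B j` (`j` in a nonempty finite family) unique optima UNDER `T` such that `T` is a single-token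
activation over each `B j` (the classes of `T` carry the exponents of `B j` off one column `e j`, where the exponent of `T` is higher — e.g.
`T = M_S` and `B j = M_{S − x_j}` in a radix-2 odometer with clean deactivations).  THEN THERE IS A COLUMN AT WHICH EVERY `B j` DIFFERS FROM
`T`: the deactivation cycles of a state pass through one common column.  Proof: the hub law (`hub_law`, …TropicalBHubLaw) for the
CLASS-REVERSED design (`ClassReversal.isDominant_classRev_iff`, …TropicalBClassReversal: `d′ = D − d ∘ rev`, slopes `θ ↦ −θ`), in which each
`revTerm (B j)` is a single-token activation over `revTerm T`. [this cell] -/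
theorem cohub_law {ι : Type*} [Fintype ι] [DecidableEq ι] [Nonempty ι] {θT : ℤ} (θ : ι → ℤ)
    {T : Equiv.Perm (Fin m) × (Fin m → Fin K)} (B : ι → Equiv.Perm (Fin m) × (Fin m → Fin K))
    (hT : IsDominant d v ε θT T) (hB : ∀ j, IsDominant d v ε (θ j) (B j))
    (e : ι → Fin m) (hc : ∀ j i, i ≠ e j → d (T.2 i) = d ((B j).2 i)) (hδ : ∀ j, d ((B j).2 (e j)) < d (T.2 (e j))) :
    ∃ col, ∀ j, ¬ ((B j).1 col = T.1 col ∧ (B j).2 col = T.2 col) := by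
  classical
  set D : ℕ := univ.sup d with hDdef
  have hD : ∀ l, d l ≤ D := fun l => Finset.le_sup (f := d) (mem_univ l)
  -- the reversed design and terms
  have hT' : IsDominant (fun l => D - d (Fin.rev l)) (fun a b l => v a b (Fin.rev l)) (fun a b l => ε a b (Fin.rev l)) (-θT)
      (ClassReversal.revTerm T) := by
    rw [ClassReversal.isDominant_classRev_iff d D v ε hD, ClassReversal.revTerm_revTerm, neg_neg]; exact hT
  have hB' : ∀ j, IsDominant (fun l => D - d (Fin.rev l)) (fun a b l => v a b (Fin.rev l)) (fun a b l => ε a b (Fin.rev l)) (-θ j)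
      (ClassReversal.revTerm (B j)) := by
    intro j
    rw [ClassReversal.isDominant_classRev_iff d D v ε hD, ClassReversal.revTerm_revTerm, neg_neg]; exact hB j
  have hc' : ∀ j i, i ≠ e j → (fun l => D - d (Fin.rev l)) ((ClassReversal.revTerm (B j)).2 i) =
      (fun l => D - d (Fin.rev l)) ((ClassReversal.revTerm T).2 i) := by
    intro j i hi
    simp only [ClassReversal.revTerm, Fin.rev_rev]
    rw [hc j i hi]
  have hδ' : ∀ j, (fun l => D - d (Fin.rev l)) ((ClassReversal.revTerm T).2 (e j)) <
      (fun l => D - d (Fin.rev l)) ((ClassReversal.revTerm (B j)).2 (e j)) := by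
    intro j
    simp only [ClassReversal.revTerm, Fin.rev_rev]
    exact Nat.sub_lt_sub_left (lt_of_lt_of_le (hδ j) (hD _)) (hδ j)
  obtain ⟨col, hcol⟩ := hub_law (fun l => D - d (Fin.rev l)) (fun a b l => v a b (Fin.rev l)) (fun a b l => ε a b (Fin.rev l))
    (fun j => -θ j) (fun j => ClassReversal.revTerm (B j)) hT' hB' e hc' hδ'
  refine ⟨col, fun j h => hcol j ?_⟩
  simp only [ClassReversal.revTerm]
  exact ⟨h.1, by rw [h.2]⟩

end CoHub

end SingleContact

end Summit.ValiantsHypothesis.ValiantsHypothesis.Theorems.KPlusLogSqLaw
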